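import Summits.QuantumFields.YangMills.Theorems.LangevinControlUVOSLegsFromFemtoAndGapStubLowerThreePoint
import Summits.QuantumFields.YangMills.Theorems.LangevinControlUVOSLegsAtWeakCouplingCStubLowerIThreePoint
import HarnessLib

/-!
# Crux `NT` (stmt-QuantumFields-19353), stub `stub_cfp : CFP`: the three-point floor from the WEAK clauses

Helper file (`--supports stmt-QuantumFields-19353`) of the fleet lead prover of crux `NT` (unit `ym-spine-19353-p1`,
g2).  CONSUMPTION AUDIT of the registered composition `NT_of = stub_lower` at the level of the clauses of `FC2` / `FC3`
(`Theorems/LangevinControlUVOSLegsFromFemtoAndGapDefs.lean` :150 / :161), three-point half: the tree's per-triple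
floor `StubLower.triple_floor` uses

* `FBL` on cubes CENTRED at the first vertex `x` (sites `x, y, z`);
* `FC2` ONLY through `cov_abs_bound`, i.e. as a SIGN-FREE clustering bound `|kerCov (dens u) (dens u')| ≤ C₂⁺/ν⁸`
  for the three pairs `(y,z), (x,z), (x,y)` of the x-centred cube (the growth clause, the continuity of `Γ` and the
  shape `Γ` itself are idle there; `Γ ≤ 1` only converts the sandwich into the absolute bound);
* `FC3` on x-centred cubes for triangles based at the centre (`1 ≤ n₃`, continuity and positivity of `Γ₃` idle:
  `lowerBounds_threePoint` destructures `⟨…, hK₃1, hK₃lim, -, -, -, hΓ₃lim, hFC3c⟩`).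

`triple_floor_weak` re-proves the per-triple floor from exactly that: the weak ABSOLUTE clause (x-centred femto
cubes, any deep pair `u, u'` at physical separation in `[s₀, ℓ₂']`, collar `K'`, `|ν⁸ · kerCov| ≤ C₂'`) and the weak
`FC3` clause (x-centred cubes, triangle based at the centre).  All real-arithmetic lemmas are the tree's; the proof
body is the tree's with the two hypotheses weakened (the sibling crux's `StubLowerI.cov_abs_boundI` — line
`inherited-amplitude-gates` of crux `OSLegsAtWeakCouplingC`, whose `FC2I` package makes the same sign-free (U) /
floor (L) split for ALL cubes — replaces `cov_abs_bound`).
-/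

set_option autoImplicit false

noncomputable section

open scoped SchwartzMap
open MeasureTheory Filter Topology
open Literature.MathematicalPhysics.QuantumFieldTheory Literature.MathematicalPhysics.QuantumLattice
open Literature.MathematicalPhysics.AQFT Literature.Probability.LatticeModels
open Summit.QuantumFields.YangMills.Theorems.OSLegsFromFemtoAndGap.StubLower
open Summit.QuantumFields.YangMills.Cruxes.OSLegsFromFemtoAndGap.DlrCollarTransfer
open Summit.QuantumFields.YangMills.Cruxes.OSLegsFromFemtoAndGap.DlrCollarTransfer.StubLower
open Summit.QuantumFields.YangMills.Cruxes.OSLegsAtWeakCouplingC.InheritedAmplitudeGates.StubLowerI (cov_abs_boundI)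

namespace Summit.QuantumFields.YangMills.Cruxes.NT.WeakPackage

section TripleFloor

variable (G : Type) [Group G] [TopologicalSpace G] [IsTopologicalGroup G] [CompactSpace G]
  [MeasurableSpace G] [BorelSpace G] (r : LatticeRep G) (a : ℝ → ℝ)

/-- **The per-triple signed cumulant floor from the weak clauses** (tree `triple_floor` with `FC2` replaced by the
sign-free x-centred clustering clause and `FC3` by its x-centred form). [folklore] -/
theorem triple_floor_weak
    {C₁ β₁ ℓ₁ : ℝ} {p : ℝ → ℝ} (hC₁ : 0 ≤ C₁)
    (hFBL : ∀ β : ℝ, β₁ ≤ β → ∀ (c : Fin 4 → ℤ) (b : ℕ), (b : ℝ) * a β ≤ ℓ₁ →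
      ∀ (η : LGConfig 4 G) (x : Fin 4 → ℤ), 2 ≤ depth c b x →
        |kerE G r β c b η (dens G r x) - p β| ≤ C₁ / (depth c b x : ℝ) ^ 4)
    {β₂ ℓ₂ C₂ : ℝ} {K : ℝ → ℝ} {n₀ : ℕ} (hK1 : ∀ s, 1 ≤ K s)
    (hAbs : ∀ β : ℝ, β₂ ≤ β → ∀ (x : Fin 4 → ℤ) (R : ℕ), ((2 * R + 1 : ℕ) : ℝ) * a β ≤ ℓ₂ →
      ∀ (η : LGConfig 4 G) (u u' : Fin 4 → ℤ) (s₀ : ℝ), 0 < s₀ → s₀ ≤ ‖siteToE (u' - u)‖ * a β →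
        ‖siteToE (u' - u)‖ * a β ≤ ℓ₂ → (n₀ : ℝ) ≤ ‖siteToE (u' - u)‖ →
          K s₀ * ‖siteToE (u' - u)‖ ≤ depth (fun j => x j - R) (2 * R + 1) u →
          K s₀ * ‖siteToE (u' - u)‖ ≤ depth (fun j => x j - R) (2 * R + 1) u' →
            |‖siteToE (u' - u)‖ ^ 8 *
                kerCov G r β (fun j => x j - R) (2 * R + 1) η (dens G r u) (dens G r u')| ≤ C₂)
    {v w : EuclideanSpace ℝ (Fin 4)} {σ δ : ℝ} {Γ₃ : ℝ → ℝ} {β₃ ℓ₃ c₃ : ℝ} {K₃ : ℝ → ℝ} {n₃ : ℕ}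
    (hσ : σ = 1 ∨ σ = -1) (hδ : 0 < δ) (hc₃ : 0 < c₃) (hK₃1 : ∀ s, 1 ≤ K₃ s)
    (hFC3 : ∀ β : ℝ, β₃ ≤ β → ∀ (x : Fin 4 → ℤ) (R : ℕ), ((2 * R + 1 : ℕ) : ℝ) * a β ≤ ℓ₃ →
      ∀ (η : LGConfig 4 G) (n : ℕ) (y z : Fin 4 → ℤ) (s₀ : ℝ), 0 < s₀ → s₀ ≤ (n : ℝ) * a β →
        n₃ ≤ n → ‖siteToE (y - x) - (n : ℝ) • v‖ ≤ δ * n → ‖siteToE (z - x) - (n : ℝ) • w‖ ≤ δ * n →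
          K₃ s₀ * n ≤ depth (fun j => x j - R) (2 * R + 1) x →
          K₃ s₀ * n ≤ depth (fun j => x j - R) (2 * R + 1) y →
          K₃ s₀ * n ≤ depth (fun j => x j - R) (2 * R + 1) z →
            c₃ * Γ₃ ((n : ℝ) * a β) ≤ σ * (n : ℝ) ^ 12 * kerK3 G r β (fun j => x j - R) (2 * R + 1) η x y z)
    {s D M₃ δ₃ Vmin Vmax : ℝ} (hs : 0 < s) (hD : 0 < D) (hM₃ : 0 ≤ M₃) (hVmin : 0 < Vmin)
    (hVv : Vmin ≤ ‖v‖ - δ / 2) (hVw : Vmin ≤ ‖w‖ - δ / 2) (hVvw : Vmin ≤ ‖w - v‖ - δ / 2)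
    (hVv' : ‖v‖ + δ / 2 ≤ Vmax) (hVw' : ‖w‖ + δ / 2 ≤ Vmax) (hVvw' : ‖w - v‖ + δ / 2 ≤ Vmax)
    (hΓ₃M : ∀ t : ℝ, 0 < t → t < δ₃ → M₃ < Γ₃ t / t ^ 4) (hsδ₃ : s < δ₃) (hsℓ₂ : s * Vmax ≤ ℓ₂)
    (hM₃C : 6 * C₁ * max C₂ 0 / (D ^ 4 * (s * Vmin) ^ 8) + 8 * C₁ ^ 3 / D ^ 12 ≤
      c₃ * M₃ / (2 * s ^ 8))
    {β : ℝ} (hβ₁ : β₁ ≤ β) (hβ₂ : β₂ ≤ β) (hβ₃ : β₃ ≤ β) (hα : 0 < a β)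
    (hαn₀ : (n₀ : ℝ) * a β ≤ s * Vmin) (hαn₃ : ((n₃ : ℝ) + 1) * a β ≤ s) (hα2 : a β ≤ s / 2)
    (hαv : a β * (‖v‖ + δ) ≤ δ * s / 2) (hαw : a β * (‖w‖ + δ) ≤ δ * s / 2)
    (hfem₁ : 2 * (K (s * Vmin) * (s * Vmax) + K₃ (s / 2) * s + D + s * Vmax) + 7 * a β ≤ ℓ₁)
    (hfem₂ : 2 * (K (s * Vmin) * (s * Vmax) + K₃ (s / 2) * s + D + s * Vmax) + 7 * a β ≤ ℓ₂)
    (hfem₃ : 2 * (K (s * Vmin) * (s * Vmax) + K₃ (s / 2) * s + D + s * Vmax) + 7 * a β ≤ ℓ₃)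
    {L : ℕ} (hL : K (s * Vmin) * (s * Vmax) + K₃ (s / 2) * s + D + s * Vmax + 4 * a β ≤ a β * L)
    (x y z : Fin 4 → ℤ) (hx : ‖a β • siteToE x‖ < δ * s / 4)
    (hy : ‖a β • siteToE y - s • v‖ < δ * s / 4) (hz : ‖a β • siteToE z - s • w‖ < δ * s / 4) :
    c₃ * M₃ / (2 * s ^ 8) * a β ^ 12 ≤ σ * torusK3 G r β L x y z := by
  have hx' : ‖a β • siteToE x - 0‖ < δ * s / 4 := by rwa [sub_zero]
  have hK0 : 0 ≤ K (s * Vmin) := by linarith only [hK1 (s * Vmin)]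
  have hK₃0 : 0 ≤ K₃ (s / 2) := by linarith only [hK₃1 (s / 2)]
  have hVmax : 0 ≤ Vmax := by linarith only [norm_nonneg v, hVv', hδ]
  have hsV : 0 < s * Vmin := mul_pos hs hVmin
  -- separations of the three pairs
  have nv : ‖s • v - (0 : EuclideanSpace ℝ (Fin 4))‖ = s * ‖v‖ := by
    rw [sub_zero, norm_smul, Real.norm_eq_abs, abs_of_pos hs]
  have nw : ‖s • w - (0 : EuclideanSpace ℝ (Fin 4))‖ = s * ‖w‖ := by
    rw [sub_zero, norm_smul, Real.norm_eq_abs, abs_of_pos hs]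
  have nwv : ‖s • w - s • v‖ = s * ‖w - v‖ := by
    rw [← smul_sub, norm_smul, Real.norm_eq_abs, abs_of_pos hs]
  obtain ⟨hxy0, hxy1, hxy2⟩ := pair_separation_centres hα x y hx' hy
  obtain ⟨hxz0, hxz1, hxz2⟩ := pair_separation_centres hα x z hx' hz
  obtain ⟨-, hyz1, hyz2⟩ := pair_separation_centres hα y z hy hz
  rw [nv] at hxy1 hxy2
  rw [nw] at hxz1 hxz2
  rw [nwv] at hyz1 hyz2
  rw [sub_zero] at hxy0 hxz0
  have hv1 := mul_le_mul_of_nonneg_left hVv hs.le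
  have hv2 := mul_le_mul_of_nonneg_left hVv' hs.le
  have hw1 := mul_le_mul_of_nonneg_left hVw hs.le
  have hw2 := mul_le_mul_of_nonneg_left hVw' hs.le
  have hvw1 := mul_le_mul_of_nonneg_left hVvw hs.le
  have hvw2 := mul_le_mul_of_nonneg_left hVvw' hs.le
  have hsxy : s * Vmin < ‖siteToE (y - x)‖ * a β ∧ ‖siteToE (y - x)‖ * a β < s * Vmax :=
    ⟨by linarith only [hv1, hxy1], by linarith only [hv2, hxy2]⟩
  have hsxz : s * Vmin < ‖siteToE (z - x)‖ * a β ∧ ‖siteToE (z - x)‖ * a β < s * Vmax :=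
    ⟨by linarith only [hw1, hxz1], by linarith only [hw2, hxz2]⟩
  have hsyz : s * Vmin < ‖siteToE (z - y)‖ * a β ∧ ‖siteToE (z - y)‖ * a β < s * Vmax :=
    ⟨by linarith only [hvw1, hyz1], by linarith only [hvw2, hyz2]⟩
  have hshy' : ‖a β • siteToE (y - x) - s • v‖ < δ * s / 2 := by linarith only [hxy0]
  have hshz' : ‖a β • siteToE (z - x) - s • w‖ < δ * s / 2 := by linarith only [hxz0]
  -- FC3's shape `n = ⌊s/α⌋`
  obtain ⟨n, hn1, hn2⟩ : ∃ n : ℕ, (n : ℝ) * a β ≤ s ∧ s < (n + 1) * a β := by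
    refine ⟨⌊s / a β⌋₊, ?_, ?_⟩
    · rw [← le_div_iff₀ hα]; exact Nat.floor_le (by positivity)
    · rw [← div_lt_iff₀ hα]; exact Nat.lt_floor_add_one _
  have hnα : 0 < (n : ℝ) * a β := by linarith only [hn2, hα2, hs]
  have hn0 : 0 < (n : ℝ) := pos_of_mul_pos_left hnα hα.le
  have hn₃n : n₃ ≤ n := by
    have : (n₃ : ℝ) < n := by
      have : (n₃ : ℝ) * a β < n * a β := by linarith only [hαn₃, hn2]
      exact lt_of_mul_lt_mul_right this hα.le
    exact_mod_cast this.le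
  have hs₀ : s / 2 ≤ n * a β := by linarith only [hn2, hα2]
  have hnδ₃ : (n : ℝ) * a β < δ₃ := hn1.trans_lt hsδ₃
  have hns : (n : ℝ) ≤ s / a β := by rw [le_div_iff₀ hα]; exact hn1
  have hshy : ‖siteToE (y - x) - (n : ℝ) • v‖ ≤ δ * n := shape_bound hα hδ x y hshy' hαv hn1 hn2
  have hshz : ‖siteToE (z - x) - (n : ℝ) • w‖ ≤ δ * n := shape_bound hα hδ x z hshz' hαw hn1 hn2
  -- the depth budget `Dep = (T + D)/α + 3`, `T = K(s Vmin) s Vmax + K₃(s/2) s`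
  have hKK : 0 ≤ K (s * Vmin) * (s * Vmax) := mul_nonneg hK0 (mul_nonneg hs.le hVmax)
  have hKK₃ : 0 ≤ K₃ (s / 2) * s := mul_nonneg hK₃0 hs.le
  have hT0 : 0 ≤ K (s * Vmin) * (s * Vmax) + K₃ (s / 2) * s := add_nonneg hKK hKK₃
  obtain ⟨Dep, hDep⟩ : ∃ Dep : ℝ, Dep = (K (s * Vmin) * (s * Vmax) + K₃ (s / 2) * s + D) / a β + 3 :=
    ⟨_, rfl⟩
  have hP : 0 ≤ (K (s * Vmin) * (s * Vmax) + K₃ (s / 2) * s + D) / a β :=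
    div_nonneg (by linarith only [hT0, hD]) hα.le
  have hDep2 : (2 : ℝ) ≤ Dep := by rw [hDep]; linarith only [hP]
  have hDep0 : 0 < Dep := by linarith only [hDep2]
  have hKdep : K (s * Vmin) * (s * Vmax / a β) ≤ Dep := by
    rw [hDep, ← mul_div_assoc]
    have : K (s * Vmin) * (s * Vmax) / a β ≤ (K (s * Vmin) * (s * Vmax) + K₃ (s / 2) * s + D) / a β :=
      div_le_div_of_nonneg_right (by linarith only [hKK₃, hD]) hα.le
    linarith only [this]
  have hK₃dep : K₃ (s / 2) * (s / a β) ≤ Dep := by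
    rw [hDep, ← mul_div_assoc]
    have : K₃ (s / 2) * s / a β ≤ (K (s * Vmin) * (s * Vmax) + K₃ (s / 2) * s + D) / a β :=
      div_le_div_of_nonneg_right (by linarith only [hKK, hD]) hα.le
    linarith only [this]
  have hDa : D / a β ≤ Dep := by
    have : D / a β ≤ (K (s * Vmin) * (s * Vmax) + K₃ (s / 2) * s + D) / a β :=
      div_le_div_of_nonneg_right (by linarith only [hT0]) hα.le
    rw [hDep]; linarith only [this]
  have hK₃ν : K₃ (s / 2) * n ≤ Dep := (mul_le_mul_of_nonneg_left hns hK₃0).trans hK₃dep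
  have hKν : ∀ {t : ℝ}, t * a β < s * Vmax → K (s * Vmin) * t ≤ Dep := fun {t} ht => by
    have : t ≤ s * Vmax / a β := by rw [le_div_iff₀ hα]; exact ht.le
    exact (mul_le_mul_of_nonneg_left this hK0).trans hKdep
  -- the cube of radius `R` around `x`
  obtain ⟨R, hR1, hRL, hRν, hfem⟩ := cube_radius_general (T := K (s * Vmin) * (s * Vmax) + K₃ (s / 2) * s)
    (νb := s * Vmax) hα hT0 hD (by positivity) hL
  obtain ⟨hνyR, hDy⟩ := hRν ‖siteToE (y - x)‖ hsxy.2.le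
  obtain ⟨hνzR, hDz⟩ := hRν ‖siteToE (z - x)‖ hsxz.2.le
  obtain ⟨-, hDx⟩ := hRν 0 (by rw [zero_mul]; positivity)
  rw [← hDep] at hDx hDy hDz
  have hyx : ∀ j, |y j - x j| + 1 ≤ (R : ℤ) := fun j => by
    have h1 := abs_sub_le_norm_siteToE x y j
    have h3 : ((|y j - x j| + 1 : ℤ) : ℝ) ≤ R := by push_cast; linarith only [h1, hνyR]
    exact_mod_cast h3
  have hzx : ∀ j, |z j - x j| + 1 ≤ (R : ℤ) := fun j => by
    have h1 := abs_sub_le_norm_siteToE x z j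
    have h3 : ((|z j - x j| + 1 : ℤ) : ℝ) ≤ R := by push_cast; linarith only [h1, hνzR]
    exact_mod_cast h3
  -- the cube is femto
  have hb : ((2 * R + 1 : ℕ) : ℝ) * a β ≤
      2 * (K (s * Vmin) * (s * Vmax) + K₃ (s / 2) * s + D + s * Vmax) + 7 * a β := by
    push_cast; exact hfem
  have hb₁ := hb.trans hfem₁
  have hb₂ := hb.trans hfem₂
  have hb₃ := hb.trans hfem₃
  -- depths of the three sites
  have hdx0 := le_depth_cube x x R (t := 0) (fun j => by simp)
  have hdx : Dep ≤ (depth (fun j => x j - R) (2 * R + 1) x : ℝ) := hDx.trans hdx0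
  have hdy : Dep ≤ (depth (fun j => x j - R) (2 * R + 1) y : ℝ) :=
    hDy.trans (le_depth_cube x y R fun j => abs_sub_le_norm_siteToE x y j)
  have hdz : Dep ≤ (depth (fun j => x j - R) (2 * R + 1) z : ℝ) :=
    hDz.trans (le_depth_cube x z R fun j => abs_sub_le_norm_siteToE x z j)
  -- the weak absolute clause: the three conditional covariances are small
  have hcov : ∀ u u' : Fin 4 → ℤ, s * Vmin < ‖siteToE (u' - u)‖ * a β →
      ‖siteToE (u' - u)‖ * a β < s * Vmax →
      Dep ≤ (depth (fun j => x j - R) (2 * R + 1) u : ℝ) →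
      Dep ≤ (depth (fun j => x j - R) (2 * R + 1) u' : ℝ) →
      ∀ η, |kerCov G r β (fun j => x j - R) (2 * R + 1) η (dens G r u) (dens G r u')| ≤
        max C₂ 0 * (a β / (s * Vmin)) ^ 8 := by
    intro u u' h1 h2 hu hu' η
    have hn₀ν : (n₀ : ℝ) ≤ ‖siteToE (u' - u)‖ := le_of_mul_le_mul_right (hαn₀.trans h1.le) hα
    have habs := hAbs β hβ₂ x R hb₂ η u u' (s * Vmin) hsV h1.le (h2.le.trans hsℓ₂) hn₀ν
      ((hKν h2).trans hu) ((hKν h2).trans hu')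
    exact cov_abs_boundI hsV hα h1.le habs
  -- FC3: the signed floor
  have hfl : ∀ η, c₃ * M₃ / s ^ 8 * a β ^ 12 ≤
      σ * kerK3 G r β (fun j => x j - R) (2 * R + 1) η x y z := fun η => by
    have h := hFC3 β hβ₃ x R hb₃ η n y z (s / 2)
      (half_pos hs) hs₀ hn₃n hshy hshz (hK₃ν.trans hdx) (hK₃ν.trans hdy) (hK₃ν.trans hdz)
    have h' : c₃ * Γ₃ (n * a β) ≤
        (n : ℝ) ^ 12 * (σ * kerK3 G r β (fun j => x j - R) (2 * R + 1) η x y z) := by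
      calc c₃ * Γ₃ (n * a β)
          ≤ σ * (n : ℝ) ^ 12 * kerK3 G r β (fun j => x j - R) (2 * R + 1) η x y z := h
        _ = _ := by ring
    exact k3_floor_of_shape hc₃ hM₃ hn0 hα hn1 (hΓ₃M _ hnα hnδ₃) h'
  -- FBL: the boundary law at depth `≥ D/α`
  have hh : ∀ u : Fin 4 → ℤ, Dep ≤ (depth (fun j => x j - R) (2 * R + 1) u : ℝ) →
      ∀ η, |kerE G r β (fun j => x j - R) (2 * R + 1) η (dens G r u) - p β| ≤
        C₁ * (a β / D) ^ 4 := by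
    intro u hu η
    have h2u : 2 ≤ depth (fun j => x j - R) (2 * R + 1) u := by
      have : (2 : ℝ) ≤ depth (fun j => x j - R) (2 * R + 1) u := hDep2.trans hu
      exact_mod_cast this
    exact boundary_of_depth hC₁ hD hα (hDep0.trans_le hu) (hDa.trans hu)
      (hFBL β hβ₁ _ _ hb₁ η u h2u)
  -- law of total cumulance
  exact half_signal3 hD hα hs hVmin hM₃C
    (k3_triple_lower G r β x y z R L hRL hR1 hyx hzx hσ (hh x hdx) (hh y hdy) (hh z hdz)
      (hcov y z hsyz.1 hsyz.2 hdy hdz) (hcov x z hsxz.1 hsxz.2 hdx hdz)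
      (hcov x y hsxy.1 hsxy.2 hdx hdy) hfl)

end TripleFloor

end Summit.QuantumFields.YangMills.Cruxes.NT.WeakPackage

end
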